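import Mathlib
import Summits.CriticalPhenomena.CardyFormulaZ2.Theorems.CardyMagicRigidityNestingRigidityUVLinearisation
import Summits.CriticalPhenomena.CardyFormulaZ2.Theorems.CardyMagicRigidityMagicFormulaTSmearedCentring
import Literature.Probability.Percolation.NestingWeightMeasurable
import HarnessLib

/-!
# Crux `NestingRigidity`, line `ring-cloud-tomography` (r5): the UNTILTED first-moment identity
# behind hypothesis (L) of `uvDecoupling_of_tilted_moments` — exactly on `𝕋`, groundwork on both

Crux `Summit.CriticalPhenomena.CardyFormulaZ2.Theses.CardyMagicRigidity.NestingRigidity`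
(stmt-CriticalPhenomena-4835), line `ring-cloud-tomography`, stub R1'
`stub_uvDecoupling : ∀ E ∈ latticeEnsembles, UVDecoupling E`.  Hypothesis (L) of the reduction
`uvDecoupling_of_tilted_moments` asks, for the ADDITIVE UV statistic
`Θ = Σ_{u ∉ tower} θ_u` (`θ_u = ∫_{W(u,·) ≠ 0} f_{t,r}`, `f_{t,r}` the cone density; tower = loops
with `B̄(0,r) ⊆ int u` and trace in `B(0,1)`) and `Θ₂ = Σ_{u ∉ tower} θ_u²`, at every small mesh:
(i) `w^N Θ`, `w^N Θ₂` integrable, (ii) `E[w^N Θ] ≤ (C − t·E N) E[w^N]`, (iii) `E[w^N Θ₂] ≤ C E[w^N]`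
(`w = magicWeight t`, `N = N_0(r,1)`).  This file proves, with no cited fact and no definition:

* §1 finitary bookkeeping: `exp (∑ᶠ_{a ∈ s} g) = ∏ᶠ_{a ∈ s} exp g` (junk values included), whence
  the measurability of `ω ↦ ∑ᶠ_{a ∈ S ω} g a` for random subsets of a countable range
  (`measurable_finsum_mem_of_subset_range`, from `measurable_finprod_mem_of_subset_range`), a
  uniform bound `|∑ᶠ_{A} g| ≤ C · #S` when the contributing members lie in a finite `S`, and
  `∑ᶠ_{s} c = #s · c`;
* §2 the PATHWISE TOWER SPLIT on both lattices: `Θ = Σ_{all loops} θ_u − t · N_0(r,1)` (honest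
  finite sums: only loops meeting `B̄(0,2)` have `θ_u ≠ 0`; every tower loop has `θ_u = t`);
* §3 on BOTH lattice ensembles: the statistics `ω ↦ ∑ᶠ_{u ∈ loops ∖ tower} g u` are measurable
  and uniformly bounded, and — conjunct (i) of (L) outright — `w^{N_0(r,1)} Θ` and
  `w^{N_0(r,1)} Θ₂` are integrable for EVERY real `w`, every mesh `δ > 0`, every `t` and
  `0 < r ≤ 1` (`integrable_towerWeight_mul_uvPhase`, `integrable_towerWeight_mul_uvPhaseSq`);
* §4 on `𝕋` the UNTILTED first-moment identity holds EXACTLY at every mesh: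
  `E_δ[Σ_{all loops} θ_u] = 0` (the smeared exact centring `smearedCentring` of crux
  `MagicFormulaT`, line `Sketch`, at the neutral cone density) and hence (registered anchor
  `integral_finsum_nestingPhase_sdiff_tower_tEns`) `E_δ[Θ] = −t · E_δ[N_0(r,1)]` — the `w = 1`
  case of (ii) with `C = 0`.

What remains for (L): the TILT TRANSFER `E[w^N Θ] − E[w^N] E[Θ] = Cov(w^N, Θ) ≤ C · E[w^N]` (RSW
decoupling of the tower weight from the UV drift; both lattices) and, on `ℤ²`, the untilted
centring `E_δ[Σ_u θ_u] = O(1)` (exact centring there needs the point reflections + self-duality of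
the bond loop representation at loop level).

Remark (why no "nesting-count field"): at criticality every point is surrounded by infinitely many
loops at every mesh, so `z ↦ #{u : W(u,z) ≠ 0}` and the separate bite sums `Σ_u φ_B(u)`,
`Σ_u φ_A(u)` are NOT finite; only the neutral combination `Σ_u θ_u = t Σ_u (φ_B − φ_A)` and the
dipole counts `#{u : W(u,x) ≠ 0, W(u,y) = 0}` are honest — this file works with those only.
-/

noncomputable section

open MeasureTheory Set Filter Metric
open scoped Real Topology BigOperators

namespace Summit.CriticalPhenomena.CardyFormulaZ2.Cruxes.NestingRigidity.RingCloudTomography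

open Literature.Probability.RandomPlanarGeometry Literature.Probability.Percolation
  Literature.Probability.LatticeModels
open Summit.CriticalPhenomena.CardyFormulaZ2.Cruxes.NestingRigidity.PositiveConeWeightDoubling
  (magicWeight meanTower coneCloud towerSet towerCount_eq_ncard_towerSet nestingPhase_coneDensity_of_tower)

namespace FirstMoment

/-! ## §1 Finitary sums: exponential, measurability, bounds, constants -/

section General

variable {α : Type*}

/-- `exp` of a `finsum` over a set is the `finprod` of the exponentials — junk values included: when
infinitely many members contribute both sides are `exp 0 = 1`. -/
theorem exp_finsum_mem (s : Set α) (g : α → ℝ) :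
    Real.exp (∑ᶠ a ∈ s, g a) = ∏ᶠ a ∈ s, Real.exp (g a) := by
  classical
  have hsupp : (Function.mulSupport fun a ↦ Real.exp (g a)) = Function.support g := by
    ext a
    simp only [Function.mem_mulSupport, Function.mem_support, ne_eq, Real.exp_eq_one_iff]
  by_cases hfin : (s ∩ Function.support g).Finite
  · have h1 : s ∩ Function.support g = ↑hfin.toFinset ∩ Function.support g := by
      rw [hfin.coe_toFinset, Set.inter_assoc, Set.inter_self]
    have h2 : (s ∩ Function.mulSupport fun a ↦ Real.exp (g a)) =
        ↑hfin.toFinset ∩ Function.mulSupport fun a ↦ Real.exp (g a) := by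
      rw [hsupp]
      exact h1
    rw [finsum_mem_eq_sum_of_inter_support_eq g h1, finprod_mem_eq_prod_of_inter_mulSupport_eq _ h2,
      Real.exp_sum]
  · rw [finsum_mem_eq_zero_of_infinite hfin, Real.exp_zero,
      finprod_mem_eq_one_of_infinite (by rwa [hsupp])]

/-- **Measurability of `ω ↦ ∑ᶠ_{a ∈ S ω} g a`** for a random set `S ω` inside the range of a map on
a countable type, with measurable membership events (`log` of the measurable `∏ᶠ exp`,
`measurable_finprod_mem_of_subset_range`). -/
theorem measurable_finsum_mem_of_subset_range {Ω K : Type*} [MeasurableSpace Ω] [Countable K]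
    (U : K → α) {S : Ω → Set α} (hSU : ∀ ω, S ω ⊆ Set.range U)
    (hS : ∀ a, Measurable fun ω ↦ a ∈ S ω) (g : α → ℝ) :
    Measurable fun ω ↦ ∑ᶠ a ∈ S ω, g a := by
  have h : (fun ω ↦ ∑ᶠ a ∈ S ω, g a) = fun ω ↦ Real.log (∏ᶠ a ∈ S ω, Real.exp (g a)) := by
    funext ω
    rw [← exp_finsum_mem, Real.log_exp]
  rw [h]
  exact Real.measurable_log.comp (measurable_finprod_mem_of_subset_range U hSU hS _)

/-- The same for the image of a random subset of a countable index type, cut by a deterministic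
predicate: `ω ↦ ∑ᶠ_{u ∈ f '' S ω, Q u} g u` is measurable. -/
theorem measurable_finsum_mem_image_sep {Ω K : Type*} [MeasurableSpace Ω] [Countable K]
    (f : K → α) {S : Ω → Set K} (hS : ∀ k, Measurable fun ω ↦ k ∈ S ω) (Q : α → Prop)
    (g : α → ℝ) : Measurable fun ω ↦ ∑ᶠ u ∈ {u ∈ f '' S ω | Q u}, g u := by
  refine measurable_finsum_mem_of_subset_range f (fun ω u hu ↦ ?_) (fun a ↦ ?_) g
  · obtain ⟨⟨k, -, rfl⟩, -⟩ := hu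
    exact ⟨k, rfl⟩
  · change Measurable fun ω ↦ (∃ k, k ∈ S ω ∧ f k = a) ∧ Q a
    exact (Measurable.exists fun k ↦ (hS k).and measurable_const).and measurable_const

/-- **Uniform bound on a finitary sum**: if the contributing members of `A` lie in a finite set `S`
and `|g| ≤ C` (`C ≥ 0`), then `|∑ᶠ_{a ∈ A} g a| ≤ C · #S`. -/
theorem abs_finsum_mem_le {A S : Set α} {g : α → ℝ} {C : ℝ} (hS : S.Finite)
    (hAS : A ∩ Function.support g ⊆ S) (hC0 : 0 ≤ C) (hC : ∀ a, |g a| ≤ C) :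
    |∑ᶠ a ∈ A, g a| ≤ C * S.ncard := by
  have hfin : (A ∩ S).Finite := hS.inter_of_right A
  have heq : ∑ᶠ a ∈ A, g a = ∑ a ∈ hfin.toFinset, g a := by
    apply finsum_mem_eq_sum_of_inter_support_eq
    rw [hfin.coe_toFinset]
    ext a
    exact ⟨fun h ↦ ⟨⟨h.1, hAS h⟩, h.2⟩, fun h ↦ ⟨h.1.1, h.2⟩⟩
  rw [heq]
  calc |∑ a ∈ hfin.toFinset, g a| ≤ ∑ a ∈ hfin.toFinset, |g a| := Finset.abs_sum_le_sum_abs _ _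
    _ ≤ ∑ _a ∈ hfin.toFinset, C := Finset.sum_le_sum fun a _ ↦ hC a
    _ = C * ((A ∩ S).ncard : ℝ) := by
        rw [Finset.sum_const, nsmul_eq_mul, mul_comm, Set.ncard_eq_toFinset_card _ hfin]
    _ ≤ C * S.ncard :=
        mul_le_mul_of_nonneg_left (by exact_mod_cast Set.ncard_le_ncard Set.inter_subset_right hS)
          hC0

/-- A constant summed over a set: `∑ᶠ_{a ∈ s} c = #s · c` (junk-consistent: both sides vanish on an
infinite set). -/
theorem finsum_mem_const_eq (s : Set α) (c : ℝ) : ∑ᶠ _a ∈ s, c = s.ncard * c := by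
  rcases s.finite_or_infinite with hs | hs
  · rw [finsum_mem_eq_finite_toFinset_sum _ hs, Finset.sum_const, Set.ncard_eq_toFinset_card s hs,
      nsmul_eq_mul]
  · rw [hs.ncard, Nat.cast_zero, zero_mul]
    by_cases hc : c = 0
    · exact finsum_mem_of_eqOn_zero fun _ _ ↦ hc
    · apply finsum_mem_eq_zero_of_infinite
      rwa [Function.support_const hc, Set.inter_univ]

/-- Removing a sub-family cut out by a predicate leaves the sub-family cut out by its negation. -/
theorem sdiff_sep_eq (s : Set α) (Q : α → Prop) : s \ {u ∈ s | Q u} = {u ∈ s | ¬Q u} := by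
  ext u
  simp only [Set.mem_sdiff, Set.mem_sep_iff, not_and]
  tauto

end General

/-! ## §2 The pathwise tower split -/

/-- **The tower carries the phase `t · N_0(r,1)`**: every tower loop has phase exactly `t` against
the cone density (`nestingPhase_coneDensity_of_tower`), so `Σ_{u ∈ tower} θ_u = t · #tower`
(junk-consistent on an infinite tower). -/
theorem finsum_towerSet_nestingPhase (c : LoopConfig ℂ) (t : ℝ) {r : ℝ} (hr : 0 < r) :
    ∑ᶠ u ∈ towerSet c r, u.nestingPhase (coneCloud t r).density = t * towerCount c 0 r 1 := by
  rw [finsum_mem_congr rfl fun u hu ↦ nestingPhase_coneDensity_of_tower hr hu.2.1 hu.2.2,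
    finsum_mem_const_eq, towerCount_eq_ncard_towerSet, mul_comm]

/-- **Pathwise tower split** for a configuration with finitely many loops meeting `B̄(0, 2)`:
`Σ_{u ∉ tower} θ_u = Σ_u θ_u − t · N_0(r,1)` (`0 < r ≤ 1`; honest finite sums: a loop missing
`B̄(0,2)` has phase `0`, `UVLinear.cone_nestingPhase_eq_zero`). -/
theorem finsum_sdiff_towerSet_nestingPhase (c : LoopConfig ℂ) (t : ℝ) {r : ℝ} (hr : 0 < r)
    (hr1 : r ≤ 1) (hfin : {u ∈ c.loops | (u.range ∩ closedBall (0 : ℂ) 2).Nonempty}.Finite) :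
    ∑ᶠ u ∈ c.loops \ towerSet c r, u.nestingPhase (coneCloud t r).density =
      (∑ᶠ u ∈ c.loops, u.nestingPhase (coneCloud t r).density) - t * towerCount c 0 r 1 := by
  have hsupp : (c.loops ∩ Function.support fun u : UnbasedLoop ℂ ↦
      u.nestingPhase (coneCloud t r).density).Finite :=
    hfin.subset fun u hu ↦
      ⟨hu.1, by_contra fun h ↦ hu.2 (UVLinear.cone_nestingPhase_eq_zero hr hr1 h)⟩
  have h := finsum_mem_add_sdiff' (fun u hu ↦ hu.1 : towerSet c r ⊆ c.loops) hsupp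
  rw [finsum_towerSet_nestingPhase c t hr] at h
  linarith

/-- **Pathwise tower split on both lattice ensembles** (every mesh `δ > 0`, every sample, every
charge `t`, `0 < r ≤ 1`), with the tower written as in hypothesis (L) of
`uvDecoupling_of_tilted_moments`: `Θ = Σ_{all loops} θ_u − t · N_0(r,1)`. -/
theorem finsum_sdiff_tower_nestingPhase_latticeEnsembles : ∀ E ∈ latticeEnsembles, ∀ {δ : ℝ},
    0 < δ → ∀ (ω : E.Ω) (t : ℝ) {r : ℝ}, 0 < r → r ≤ 1 →
    ∑ᶠ u ∈ (E.X δ ω).loops \ {u ∈ (E.X δ ω).loops |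
        Metric.closedBall (0 : ℂ) r ⊆ {z | u.wind z ≠ 0} ∧ u.range ⊆ Metric.ball (0 : ℂ) 1},
        u.nestingPhase (coneCloud t r).density =
      (∑ᶠ u ∈ (E.X δ ω).loops, u.nestingPhase (coneCloud t r).density) -
        t * towerCount (E.X δ ω) 0 r 1 :=
  fun E hE _ hδ ω t _ hr hr1 ↦
    finsum_sdiff_towerSet_nestingPhase _ t hr hr1 (ConeTilt.finite_loops_meeting E hE hδ ω 2)

/-! ## §3 Measurability, bounds and integrability on both lattice ensembles -/

/-- On both lattice ensembles, `ω ↦ ∑ᶠ_{u ∈ loops, Q u} g u` is measurable for EVERY deterministic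
predicate `Q` and real function `g` on loops (countable index presentations `loops_zEns_eq_image`,
`loops_tEns_eq_image`). -/
theorem measurable_finsum_loops_sep : ∀ E ∈ latticeEnsembles, ∀ (δ : ℝ) (Q : UnbasedLoop ℂ → Prop)
    (g : UnbasedLoop ℂ → ℝ), Measurable fun ω ↦ ∑ᶠ u ∈ {u ∈ (E.X δ ω).loops | Q u}, g u := by
  intro E hE δ Q g
  haveI := countable_sigma_hexLoop
  simp only [latticeEnsembles, Set.mem_insert_iff, Set.mem_singleton_iff] at hE
  rcases hE with rfl | rfl
  · simp_rw [loops_zEns_eq_image]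
    exact measurable_finsum_mem_image_sep _ measurable_mem_bondIndex Q g
  · simp_rw [loops_tEns_eq_image]
    exact measurable_finsum_mem_image_sep _ measurable_mem_siteIndex Q g

/-- … in particular `ω ↦ ∑ᶠ_{u ∈ loops} g u` is measurable … -/
theorem measurable_finsum_loops : ∀ E ∈ latticeEnsembles, ∀ (δ : ℝ) (g : UnbasedLoop ℂ → ℝ),
    Measurable fun ω ↦ ∑ᶠ u ∈ (E.X δ ω).loops, g u := by
  intro E hE δ g
  have h := measurable_finsum_loops_sep E hE δ (fun _ ↦ True) g
  simp only [Set.sep_true] at h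
  exact h

/-- … and so is `ω ↦ ∑ᶠ_{u ∈ loops ∖ {u ∈ loops | Q u}} g u` (e.g. the non-tower sums `Θ`, `Θ₂`). -/
theorem measurable_finsum_loops_sdiff_sep : ∀ E ∈ latticeEnsembles, ∀ (δ : ℝ)
    (Q : UnbasedLoop ℂ → Prop) (g : UnbasedLoop ℂ → ℝ),
    Measurable fun ω ↦ ∑ᶠ u ∈ (E.X δ ω).loops \ {u ∈ (E.X δ ω).loops | Q u}, g u := by
  intro E hE δ Q g
  simp_rw [sdiff_sep_eq]
  exact measurable_finsum_loops_sep E hE δ _ g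

/-- **On both lattices the number of loops meeting a ball is bounded by a deterministic constant**
(mesh `δ > 0`; corners, resp. faces, of a finite box). -/
theorem exists_ncard_loops_meeting_le : ∀ E ∈ latticeEnsembles, ∀ {δ : ℝ}, 0 < δ → ∀ R : ℝ,
    ∃ N : ℕ, ∀ ω : E.Ω,
      {u ∈ (E.X δ ω).loops | (u.range ∩ closedBall (0 : ℂ) R).Nonempty}.Finite ∧
        {u ∈ (E.X δ ω).loops | (u.range ∩ closedBall (0 : ℂ) R).Nonempty}.ncard ≤ N := by
  intro E hE δ hδ R
  simp only [latticeEnsembles, Set.mem_insert_iff, Set.mem_singleton_iff] at hE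
  rcases hE with rfl | rfl
  · exact ⟨_, fun ω ↦ ncard_loops_meeting_le hδ R ω⟩
  · exact ⟨_, fun ω ↦ ncard_loops_siteLoopConfig_meeting_le hδ R ω⟩

/-- **Uniform bound on cone-supported loop statistics** on both lattices: if `|g| ≤ C` and `g u = 0`
whenever the cone phase `θ_u` vanishes (e.g. `g = θ`, `g = θ²`), then `|∑ᶠ_{u ∈ loops ∖ T} g u| ≤ B`
for one constant `B = B(δ)`, all samples and ALL excluded families `T`. -/
theorem exists_abs_finsum_sdiff_le : ∀ E ∈ latticeEnsembles, ∀ {δ : ℝ}, 0 < δ → ∀ (t : ℝ) {r : ℝ},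
    0 < r → r ≤ 1 → ∀ (g : UnbasedLoop ℂ → ℝ) {C : ℝ}, 0 ≤ C → (∀ u, |g u| ≤ C) →
    (∀ u : UnbasedLoop ℂ, u.nestingPhase (coneCloud t r).density = 0 → g u = 0) →
    ∃ B : ℝ, ∀ (ω : E.Ω) (T : Set (UnbasedLoop ℂ)), |∑ᶠ u ∈ (E.X δ ω).loops \ T, g u| ≤ B := by
  intro E hE δ hδ t r hr hr1 g C hC0 hC hg
  obtain ⟨N, hN⟩ := exists_ncard_loops_meeting_le E hE hδ 2
  refine ⟨C * N, fun ω T ↦ ?_⟩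
  obtain ⟨hfin, hle⟩ := hN ω
  refine (abs_finsum_mem_le hfin (fun u hu ↦ ⟨hu.1.1, ?_⟩) hC0 hC).trans ?_
  · by_contra h
    exact hu.2 (hg u (UVLinear.cone_nestingPhase_eq_zero hr hr1 h))
  · exact mul_le_mul_of_nonneg_left (by exact_mod_cast hle) hC0

/-- **Integrability of `w^{N_0(r,1)} · Σ_{u ∉ tower} g u` on both lattices**, for EVERY real weight
`w`, mesh `δ > 0`, charge `t`, `0 < r ≤ 1` and every bounded `g` supported where the cone phase is
non-zero (bounded measurable integrand, probability law). -/
theorem integrable_towerWeight_mul_finsum_sdiff_tower : ∀ E ∈ latticeEnsembles, ∀ {δ : ℝ}, 0 < δ →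
    ∀ (w t : ℝ) {r : ℝ}, 0 < r → r ≤ 1 → ∀ (g : UnbasedLoop ℂ → ℝ) {C : ℝ}, 0 ≤ C →
    (∀ u, |g u| ≤ C) → (∀ u : UnbasedLoop ℂ, u.nestingPhase (coneCloud t r).density = 0 → g u = 0) →
    Integrable (fun ω ↦ w ^ towerCount (E.X δ ω) 0 r 1 *
      ∑ᶠ u ∈ (E.X δ ω).loops \ {u ∈ (E.X δ ω).loops |
        Metric.closedBall (0 : ℂ) r ⊆ {z | u.wind z ≠ 0} ∧ u.range ⊆ Metric.ball (0 : ℂ) 1}, g u)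
      E.P := by
  intro E hE δ hδ w t r hr hr1 g C hC0 hC hg
  haveI := isProbabilityMeasure_of_mem hE
  obtain ⟨B, hB⟩ := exists_abs_finsum_sdiff_le E hE hδ t hr hr1 g hC0 hC hg
  obtain ⟨N, hN⟩ := ConeTilt.exists_towerCount_le E hE hδ 0 r 1
  have hm : Measurable fun ω ↦ w ^ towerCount (E.X δ ω) 0 r 1 *
      ∑ᶠ u ∈ (E.X δ ω).loops \ {u ∈ (E.X δ ω).loops |
        Metric.closedBall (0 : ℂ) r ⊆ {z | u.wind z ≠ 0} ∧ u.range ⊆ Metric.ball (0 : ℂ) 1}, g u :=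
    ((measurable_towerCount E hE δ 0 r 1).const_pow w).mul
      (measurable_finsum_loops_sdiff_sep E hE δ _ g)
  refine Integrable.of_bound hm.aestronglyMeasurable (max 1 |w| ^ N * B)
    (Eventually.of_forall fun ω ↦ ?_)
  rw [Real.norm_eq_abs, abs_mul, abs_pow]
  have hB0 : 0 ≤ B := (abs_nonneg _).trans (hB ω ∅)
  exact mul_le_mul ((pow_le_pow_left₀ (abs_nonneg w) (le_max_right 1 |w|) _).trans
    (pow_le_pow_right₀ (le_max_left 1 |w|) (hN ω))) (hB ω _) (abs_nonneg _) (by positivity)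

/-- **Conjunct (i) of hypothesis (L), first half: `w^{N_0(r,1)} Θ` is integrable** on both lattices
for every real `w` (in particular `w = magicWeight t`), mesh `δ > 0`, charge `t` and `0 < r ≤ 1`. -/
theorem integrable_towerWeight_mul_uvPhase : ∀ E ∈ latticeEnsembles, ∀ {δ : ℝ}, 0 < δ →
    ∀ (w t : ℝ) {r : ℝ}, 0 < r → r ≤ 1 →
    Integrable (fun ω ↦ w ^ towerCount (E.X δ ω) 0 r 1 *
      ∑ᶠ u ∈ (E.X δ ω).loops \ {u ∈ (E.X δ ω).loops |
        Metric.closedBall (0 : ℂ) r ⊆ {z | u.wind z ≠ 0} ∧ u.range ⊆ Metric.ball (0 : ℂ) 1},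
        u.nestingPhase (coneCloud t r).density) E.P :=
  fun E hE _ hδ w t r hr hr1 ↦
    integrable_towerWeight_mul_finsum_sdiff_tower E hE hδ w t hr hr1 _ (abs_nonneg t)
      (fun u ↦ ConeTilt.abs_cone_nestingPhase_le (𝔠 := coneCloud t r) rfl hr u) fun _ h ↦ h

/-- **Conjunct (i) of hypothesis (L), second half: `w^{N_0(r,1)} Θ₂` is integrable** on both
lattices for every real `w`, mesh `δ > 0`, charge `t` and `0 < r ≤ 1`. -/
theorem integrable_towerWeight_mul_uvPhaseSq : ∀ E ∈ latticeEnsembles, ∀ {δ : ℝ}, 0 < δ →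
    ∀ (w t : ℝ) {r : ℝ}, 0 < r → r ≤ 1 →
    Integrable (fun ω ↦ w ^ towerCount (E.X δ ω) 0 r 1 *
      ∑ᶠ u ∈ (E.X δ ω).loops \ {u ∈ (E.X δ ω).loops |
        Metric.closedBall (0 : ℂ) r ⊆ {z | u.wind z ≠ 0} ∧ u.range ⊆ Metric.ball (0 : ℂ) 1},
        u.nestingPhase (coneCloud t r).density ^ 2) E.P :=
  fun E hE _ hδ w t r hr hr1 ↦
    integrable_towerWeight_mul_finsum_sdiff_tower E hE hδ w t hr hr1 _ (sq_nonneg t)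
      (fun u ↦ by
        rw [abs_pow, ← sq_abs t]
        exact pow_le_pow_left₀ (abs_nonneg _)
          (ConeTilt.abs_cone_nestingPhase_le (𝔠 := coneCloud t r) rfl hr u) 2)
      fun _ h ↦ by rw [h, sq, mul_zero]

/-- The untilted statistics themselves are integrable (`w = 1`): `Θ` … -/
theorem integrable_uvPhase : ∀ E ∈ latticeEnsembles, ∀ {δ : ℝ}, 0 < δ → ∀ (t : ℝ) {r : ℝ},
    0 < r → r ≤ 1 →
    Integrable (fun ω ↦ ∑ᶠ u ∈ (E.X δ ω).loops \ {u ∈ (E.X δ ω).loops |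
        Metric.closedBall (0 : ℂ) r ⊆ {z | u.wind z ≠ 0} ∧ u.range ⊆ Metric.ball (0 : ℂ) 1},
        u.nestingPhase (coneCloud t r).density) E.P := by
  intro E hE δ hδ t r hr hr1
  have h := integrable_towerWeight_mul_uvPhase E hE hδ 1 t hr hr1
  simp only [one_pow, one_mul] at h
  exact h

/-- … the tower count (as a real random variable) … -/
theorem integrable_towerCount : ∀ E ∈ latticeEnsembles, ∀ {δ : ℝ}, 0 < δ → ∀ (x : ℂ) (ρ R : ℝ),
    Integrable (fun ω ↦ (towerCount (E.X δ ω) x ρ R : ℝ)) E.P := by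
  intro E hE δ hδ x ρ R
  haveI := isProbabilityMeasure_of_mem hE
  obtain ⟨N, hN⟩ := ConeTilt.exists_towerCount_le E hE hδ x ρ R
  refine Integrable.of_bound
    (measurable_from_nat.comp (measurable_towerCount E hE δ x ρ R)).aestronglyMeasurable N
    (Eventually.of_forall fun ω ↦ ?_)
  rw [Real.norm_eq_abs, Nat.abs_cast]
  exact_mod_cast hN ω

/-- … and the total cone phase `Σ_{all loops} θ_u` (`= Θ + t · N_0(r,1)` pathwise). -/
theorem integrable_finsum_nestingPhase : ∀ E ∈ latticeEnsembles, ∀ {δ : ℝ}, 0 < δ → ∀ (t : ℝ)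
    {r : ℝ}, 0 < r → r ≤ 1 →
    Integrable (fun ω ↦ ∑ᶠ u ∈ (E.X δ ω).loops, u.nestingPhase (coneCloud t r).density) E.P := by
  intro E hE δ hδ t r hr hr1
  have h := (integrable_uvPhase E hE hδ t hr hr1).add
    ((integrable_towerCount E hE hδ 0 r 1).const_mul t)
  refine h.congr (Eventually.of_forall fun ω ↦ ?_)
  rw [Pi.add_apply, finsum_sdiff_tower_nestingPhase_latticeEnsembles E hE hδ ω t hr hr1]
  ring

/-! ## §4 The exact untilted first-moment identity on `𝕋` -/

/-- **Exact centring of the cone phases on `𝕋`**: at every mesh `δ > 0`, for every charge `t` and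
`0 < r ≤ 1`, `E_δ[Σ_{all loops} θ_u] = 0` — the smeared exact centring `smearedCentring` (crux
`MagicFormulaT`, line `Sketch`: point-reflection symmetry of `𝕋` through half-lattice points and the
Voronoi-cell bridge) at the neutral, bounded, compactly supported cone density. -/
theorem integral_finsum_nestingPhase_tEns {δ : ℝ} (hδ : 0 < δ) (t : ℝ) {r : ℝ} (hr : 0 < r)
    (hr1 : r ≤ 1) :
    ∫ ω, (∑ᶠ u ∈ (tEns.X δ ω).loops, u.nestingPhase (coneCloud t r).density) ∂tEns.P = 0 :=
  Summit.CriticalPhenomena.CardyFormulaZ2.Cruxes.MagicFormulaT.LineSketch.smearedCentring half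
    (coneCloud t r).density 2 _ δ (CloudAdmissibility.measurable_density _)
    (CloudAdmissibility.abs_density_le _)
    (fun _ hz ↦ ConeTilt.cone_density_eq_zero (𝔠 := coneCloud t r) rfl (by linarith) hz)
    (ConeTilt.integral_cone_density (𝔠 := coneCloud t r) rfl hr hr1) hδ

/-- **The untilted mean of the UV statistic on `𝕋`, exactly**: `E_δ[Θ] = −t · E_δ[N_0(r,1)]` at
every mesh `δ > 0`, for every charge `t` and `0 < r ≤ 1` (tower split + exact centring). -/
theorem integral_uvPhase_tEns {δ : ℝ} (hδ : 0 < δ) (t : ℝ) {r : ℝ} (hr : 0 < r) (hr1 : r ≤ 1) :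
    ∫ ω, (∑ᶠ u ∈ (tEns.X δ ω).loops \ {u ∈ (tEns.X δ ω).loops |
        Metric.closedBall (0 : ℂ) r ⊆ {z | u.wind z ≠ 0} ∧ u.range ⊆ Metric.ball (0 : ℂ) 1},
        u.nestingPhase (coneCloud t r).density) ∂tEns.P = -t * meanTower tEns δ r := by
  simp_rw [finsum_sdiff_tower_nestingPhase_latticeEnsembles tEns tEns_mem hδ _ t hr hr1]
  rw [integral_sub (integrable_finsum_nestingPhase tEns tEns_mem hδ t hr hr1)
      ((integrable_towerCount tEns tEns_mem hδ 0 r 1).const_mul t),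
    integral_finsum_nestingPhase_tEns hδ t hr hr1, integral_const_mul]
  rw [show meanTower tEns δ r = ∫ ω, (towerCount (tEns.X δ ω) 0 r 1 : ℝ) ∂tEns.P from rfl]
  ring

end FirstMoment

/-- **The UNTILTED first-moment identity behind hypothesis (L) of `uvDecoupling_of_tilted_moments`,
EXACTLY, on `𝕋`** (registered helper toward stub R1' `stub_uvDecoupling`, line
`ring-cloud-tomography` r5).  For every mesh `δ > 0`, every charge `t` and every `0 < r ≤ 1`, the
additive UV statistic `Θ = Σ_{u ∉ tower} θ_u` of the cone cloud (`θ_u = ∫_{W(u,·) ≠ 0} f_{t,r}`,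
tower = loops with `B̄(0,r) ⊆ {W ≠ 0}` and trace in `B(0,1)`, written as in (L)) has mean
`E_δ[Θ] = −t · E_δ[N_0(r,1)] = −t · meanTower tEns δ r`: pathwise `Θ = Σ_u θ_u − t N_0(r,1)` (every
tower loop has phase `t`), and `E_δ[Σ_u θ_u] = 0` identically (smeared exact centring on `𝕋`).  What
(L) still needs is the tilt transfer `Cov(w^N, Θ) ≤ C · E[w^N]`. -/
theorem integral_finsum_nestingPhase_sdiff_tower_tEns : ∀ {δ : ℝ}, 0 < δ → ∀ (t : ℝ) {r : ℝ},
    0 < r → r ≤ 1 →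
    ∫ ω, (∑ᶠ u ∈ (tEns.X δ ω).loops \ {u ∈ (tEns.X δ ω).loops |
        Metric.closedBall (0 : ℂ) r ⊆ {z | u.wind z ≠ 0} ∧ u.range ⊆ Metric.ball (0 : ℂ) 1},
        u.nestingPhase (coneCloud t r).density) ∂tEns.P = -t * meanTower tEns δ r :=
  fun hδ t _ hr hr1 ↦ FirstMoment.integral_uvPhase_tEns hδ t hr hr1

end Summit.CriticalPhenomena.CardyFormulaZ2.Cruxes.NestingRigidity.RingCloudTomography

end
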